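import Summits.QuantumFields.BalabanUV.T4Continuum.Support.NE3NestedMeanBlockOperator
import Summits.QuantumFields.BalabanUV.T4Continuum.Support.NE3NearScalarSolve
import Summits.QuantumFields.BalabanUV.T4Continuum.Support.NE3CovariantTentInterpolantMean
import HarnessLib

/-!
# T⁴ programme, node NE3 — row E-MLw-(w4)-P-curved, route H♮, row K5c (file 6b): THE NESTED-MEAN FIX OF A COMPETITOR —
# a dressed bump whose coefficient solves the per-block near-scalar equation makes the NESTED transported mean EXACT

NE3 (node U1b) formalisation swarm, leaf seat `b2b-balaban-t4-ne3-formalise-leaf-01` (gen 6); row **K5** of ruling ρ-g22-2, sub-row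
**K5c**; junction J-ne3leaf02g6-1 (leaf-02-g6, K6 holder) and owner RULING ρ-g23-5 (`HOME/CLAIMS.log` 2026-08-20 ≈19:00Z ∕ ≈19:03Z):
«the S7 competitor must be NESTED-mean exact (`bmeanIterW L k W`, the clause of `Ξ₀₀(W)` in K0b's `mem_cornerGaugeSpaceW_iff`);
repair (α): `ζ̃ := ζ̃₀ + dressW (bump c)` with `c z := A_z⁻¹(target − nested mean of ζ̃₀)`».  Over file 6a `NE3NestedMeanBlockOperator`
(`Kop`, block locality, `star`-equivariance, periodicity), the owner's K5-inv `NE3NearScalarSolve` (`nearScalarInv`, `nearScalarInv_eq`,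
`nearScalarInv_map_comm`, `gauge_injective`, `gauge_nearScalarInv_le`) and the lineage's file 3 `NE3CovariantTentInterpolantMean`
(`sum_normSq_gaugeDir_dressW_bump_le`) BY NAME.

CONTENT ([folklore]; 0 sorry; DATA defs `starL`, `nfixCoef`, `nfixW`), `M = L^(j+1)`, multi-level small-field class (`L ≥ 2`, `W` unitary,
`0 ≤ x`, `LevelSmall d L j x`, `SmallField W x`) and the ONE smallness line **`E_j ≤ 1∕2`** (`E_j` = J2's bridge constant
`4d²(M−1)²x + 16d·loopRad(d,L,r_j)` = O(b∕L²)):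
§1 `starL`; `norm_Kop_le_half` (`‖Kop X‖ ≤ (tentMean∕2)·‖X‖`);
§2 **`nfixCoef … δ z := nearScalarInv … (Kop L j W z) … (δ z)`**: `nfixCoef_eq` (`tentMean•c + Kop c = δ z`), `norm_nfixCoef_le`
   (`‖c‖ ≤ (2∕tentMean)·‖δ z‖`, `tentMean ≥ 8^{−d}`), `nfixCoef_mem_skewAdjoint` (skew data ⇒ skew coefficient, via `star_Kop`),
   `nfixCoef_add_period`;
§3 **`nfixW … F₀ t := F₀ + dressW M W (bump M (nfixCoef … (t − bmeanIterW L (j+1) W F₀)))`**: **`bmeanIterW_nfixW`**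
   (`bmeanIterW L (j+1) W (nfixW F₀ t) z = t z` EXACTLY), `nfixW_corner` (corners of `F₀` unchanged), `nfixW_mem_skewAdjoint`,
   `nfixW_add_period`, and the energy **`sum_normSq_gaugeDir_nfixW_le`**:
   `Σ‖gaugeDir W (nfixW F₀ t)‖² ≤ 2·Σ‖gaugeDir W F₀‖² + 2·d·M^d·(1∕M + 2(d−1)(M−1)a)²·(2∕tentMean)²·Σ_z ‖t z − bmeanIterW L (j+1) W F₀ z‖²`.
   The K6 consumer takes `F₀ := competitorW (L^k) W b c` (file 5: exact corners `c`, single-scale means `b := bmeanW (L^k) W ζ′`),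
   `t := bmeanIterW L k W ζ′`; then `t − bmeanIterW F₀ = −(bmeanIterW − bmeanW)(F₀ − ζ′)` is J2-small (ρ-g23-5's bookkeeping).

HONEST FRAMING.  Kinematics of OUR competitor at one background in the multi-level small-field class + the owner's finite-dimensional linear
algebra; nothing about Bałaban's minimisers; (P♮)_W ∕ (ML_w) at W ≠ 1, T-E_w and **NE3 are NOT proved**; spine PROVED 0∕9; finite T⁴
rung (B)+1 — NOT infinite volume, NOT mass gap, NOT `BetaPertH`, NOT Clay.  PLACEMENT: `Summits/QuantumFields/BalabanUV/`.  HONEST DEPENDENCY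
(cell page 1): continuum YM on T⁴ ⇐ BetaPertH ∧ nine spine estimates (0/9 proved); BetaPertH ⇐ (D1) ∧ (D4) ∧ CAP+tail; G-an2-4 gates asym,
D1 and NE2/3/4.
-/

set_option autoImplicit false

open scoped BigOperators Matrix.Norms.L2Operator
open Finset

namespace Summit.QuantumFields.BalabanUV.T4Continuum.NE3CompetitorNestedFix

open Literature.MathematicalPhysics.QuantumFieldTheory.Balaban1983to89
open B7Prop1Explicit B7Prop2Explicit
open T4AveragingDeficitWall (IsUnitaryCfg SmallField Ad)
open T4AveragingDeficitWallBoundary (periodBox mem_periodBox card_periodBox IsPeriodicCfg)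
open AveragingDeficitTransport (norm_Ad_of_unitary)
open AveragingDeficitNearIdentity (Ad_add)
open AveragingDeficitTwoLevelPrep (prop1Radius)
open AveragingDeficitMultiLevelPrep (tower LevelSmall)
open BlockAveragePushDirGauge (gaugeDir)
open NE3CovariantBlockMean (bmeanW bmeanIterW)
open NE3FrameFreeSliceW (bmeanIterW_add bmeanIterW_smul)
open NE3DressedBlockField (dressW dressW_corner dressW_mem_skewAdjoint dressW_add_period)
open NE3TentBump (tent bump bump_corner bump_add_period)
open NE3CovariantTentInterpolantMean (sum_normSq_gaugeDir_dressW_bump_le)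
open NE3CurvedProjectedLandau (tower_eq_pow_mul)
open NE3NearScalarSolve (nearScalarInv nearScalarInv_eq nearScalarInv_map_comm gauge_injective gauge_nearScalarInv_le norm_smul_abs)
open NE3NestedMeanBlockOperator (bmeanIterW_congr_block bmeanIterW_add_period' star_bmeanIterW cbumpW dressW_bump_block tentMean
  tentMean_pos inv_le_tentMean Kop Kop_apply norm_Kop_le star_Kop Kop_add_period)
open SpreadLift (loopRad)

noncomputable section

/-! ## §1 `star` as a real-linear map; the half-scalar bound -/

/-- `star` (conjugate transpose) as an ℝ-linear map of `Matrix m m ℂ`. [folklore] -/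
def starL {m : Type*} : Matrix m m ℂ →ₗ[ℝ] Matrix m m ℂ where
  toFun := star
  map_add' := star_add
  map_smul' r X := by rw [star_smul, star_trivial r]; rfl

/-- `starL X = star X`. [folklore] -/
@[simp] theorem starL_apply {m : Type*} (X : Matrix m m ℂ) : starL X = star X := rfl

variable {d : ℕ} {n : Type*} [Fintype n] [DecidableEq n]

section Fix

variable [Nonempty n] {L : ℕ} (hL : 2 ≤ L) (j : ℕ) {W : Site d → Fin d → (Matrix n n ℂ)ˣ} {x : ℝ}
  (hWu : IsUnitaryCfg W) (hx : 0 ≤ x) (hsm : LevelSmall d L j x) (hWx : SmallField W x)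
  (hE : 4 * (d : ℝ) ^ 2 * ((L : ℝ) ^ (j + 1) - 1) ^ 2 * x + 16 * d * loopRad d L ((prop1Radius d L)^[j] x) ≤ 1 / 2)

include hL hWu hx hsm hWx hE in
/-- Under `E_j ≤ 1∕2` the block operator is half-scalar: `‖Kop L j W z X‖ ≤ (tentMean∕2)·‖X‖`. [folklore] -/
theorem norm_Kop_le_half (z : Site d) (X : Matrix n n ℂ) : ‖Kop L j W z X‖ ≤ tentMean d (L ^ (j + 1)) / 2 * ‖X‖ := by
  have ht := tentMean_pos (Nat.le_trans hL (Nat.le_self_pow (Nat.succ_ne_zero j) L)) d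
  refine (norm_Kop_le hL j hWu hx hsm hWx z X).trans ?_
  have h0 : 0 ≤ tentMean d (L ^ (j + 1)) * ‖X‖ := by positivity
  nlinarith only [hE, h0]

/-! ## §2 The coefficient of the nested-mean fix -/

/-- **THE COEFFICIENT**: per block, the solution of the near-scalar equation `tentMean•c + Kop c = δ z` (the owner's K5-inv). [folklore] -/
def nfixCoef (δ : Site d → Matrix n n ℂ) (z : Site d) : Matrix n n ℂ :=
  nearScalarInv norm_smul_abs norm_add_le (fun _ h => norm_eq_zero.1 h) (Kop L j W z)
    (tentMean_pos (Nat.le_trans hL (Nat.le_self_pow (Nat.succ_ne_zero j) L)) d).le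
    (half_lt_self (tentMean_pos (Nat.le_trans hL (Nat.le_self_pow (Nat.succ_ne_zero j) L)) d))
    (norm_Kop_le_half hL j hWu hx hsm hWx hE z) (δ z)

/-- **THE EQUATION**: `tentMean • c + Kop c = δ z`. [folklore] -/
theorem nfixCoef_eq (δ : Site d → Matrix n n ℂ) (z : Site d) :
    tentMean d (L ^ (j + 1)) • nfixCoef hL j hWu hx hsm hWx hE δ z + Kop L j W z (nfixCoef hL j hWu hx hsm hWx hE δ z) = δ z :=
  nearScalarInv_eq _ _ _ _ _ _ _ _

/-- **THE SIZE OF THE COEFFICIENT**: `‖nfixCoef … δ z‖ ≤ (2∕tentMean)·‖δ z‖` (and `tentMean ≥ 8^{−d}`). [folklore] -/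
theorem norm_nfixCoef_le (δ : Site d → Matrix n n ℂ) (z : Site d) :
    ‖nfixCoef hL j hWu hx hsm hWx hE δ z‖ ≤ 2 / tentMean d (L ^ (j + 1)) * ‖δ z‖ := by
  have ht := tentMean_pos (Nat.le_trans hL (Nat.le_self_pow (Nat.succ_ne_zero j) L)) d
  have h := gauge_nearScalarInv_le norm_smul_abs norm_add_le (fun _ h => norm_eq_zero.1 h) (Kop L j W z) ht.le (half_lt_self ht)
    (norm_Kop_le_half hL j hWu hx hsm hWx hE z) (δ z)
  refine h.trans (le_of_eq ?_)
  field_simp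
  ring

/-- **SKEW DATA GIVE A SKEW COEFFICIENT** (`Kop` commutes with `star`, so the inverse does). [folklore] -/
theorem nfixCoef_mem_skewAdjoint (δ : Site d → Matrix n n ℂ) (z : Site d) (hδ : δ z ∈ skewAdjoint (Matrix n n ℂ)) :
    nfixCoef hL j hWu hx hsm hWx hE δ z ∈ skewAdjoint (Matrix n n ℂ) := by
  have hL1 : 1 ≤ L := by omega
  rw [skewAdjoint.mem_iff] at hδ ⊢
  have hcomm : ∀ c, starL (Kop L j W z c) = Kop L j W z (starL c) := fun c => by
    rw [starL_apply, starL_apply, star_Kop hL1 j hWu hx hsm hWx z c]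
  have h := nearScalarInv_map_comm norm_smul_abs norm_add_le (fun _ h => norm_eq_zero.1 h) (Kop L j W z)
    (tentMean_pos (Nat.le_trans hL (Nat.le_self_pow (Nat.succ_ne_zero j) L)) d).le
    (half_lt_self (tentMean_pos (Nat.le_trans hL (Nat.le_self_pow (Nat.succ_ne_zero j) L)) d))
    (norm_Kop_le_half hL j hWu hx hsm hWx hE z) starL hcomm (δ z)
  rw [starL_apply, starL_apply, hδ, map_neg] at h
  unfold nfixCoef
  exact h.symm

/-- **PERIODICITY OF THE COEFFICIENT** (`W` of period `tower L N (j+1)`, `δ` `N`-periodic). [folklore] -/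
theorem nfixCoef_add_period {N : ℕ} (hWP : IsPeriodicCfg W ((tower L N (j + 1) : ℕ) : ℤ)) {δ : Site d → Matrix n n ℂ}
    (hδ : ∀ (z : Site d) (i : Fin d), δ (z + (N : ℤ) • e i) = δ z) (z : Site d) (i : Fin d) :
    nfixCoef hL j hWu hx hsm hWx hE δ (z + (N : ℤ) • e i) = nfixCoef hL j hWu hx hsm hWx hE δ z := by
  have hL1 : 1 ≤ L := by omega
  have ht := tentMean_pos (Nat.le_trans hL (Nat.le_self_pow (Nat.succ_ne_zero j) L)) d
  have h1 := nfixCoef_eq hL j hWu hx hsm hWx hE δ (z + (N : ℤ) • e i)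
  have h2 := nfixCoef_eq hL j hWu hx hsm hWx hE δ z
  rw [Kop_add_period hL1 j hWP z i, hδ] at h1
  have hinj := gauge_injective norm_smul_abs norm_add_le (fun _ h => norm_eq_zero.1 h) (Kop L j W z) ht.le (half_lt_self ht)
    (norm_Kop_le_half hL j hWu hx hsm hWx hE z)
  apply hinj
  simp only [LinearMap.add_apply, LinearMap.smul_apply, LinearMap.id_apply]
  rw [h1, h2]

/-! ## §3 The fixed competitor -/

/-- **THE NESTED-MEAN FIX** of a competitor `F₀` towards the nested-mean target `t`:
`F₀ + dressW M W (bump M (nfixCoef (t − bmeanIterW L (j+1) W F₀)))`. [folklore] -/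
def nfixW (F₀ t : Site d → Matrix n n ℂ) : Site d → Matrix n n ℂ :=
  fun y => F₀ y + dressW (L ^ (j + 1)) W (bump (L ^ (j + 1))
    (nfixCoef hL j hWu hx hsm hWx hE (fun z => t z - bmeanIterW L (j + 1) W F₀ z))) y

/-- **THE NESTED TRANSPORTED MEAN OF THE FIXED COMPETITOR IS THE TARGET, EXACTLY**:
`bmeanIterW L (j+1) W (nfixW … F₀ t) z = t z`. [folklore] -/
theorem bmeanIterW_nfixW (F₀ t : Site d → Matrix n n ℂ) (z : Site d) :
    bmeanIterW L (j + 1) W (nfixW hL j hWu hx hsm hWx hE F₀ t) z = t z := by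
  have hL1 : 1 ≤ L := by omega
  have hM1 : 1 ≤ L ^ (j + 1) := Nat.one_le_pow _ _ hL1
  set c := nfixCoef hL j hWu hx hsm hWx hE (fun z => t z - bmeanIterW L (j + 1) W F₀ z) with hc
  have hsplit : nfixW hL j hWu hx hsm hWx hE F₀ t = F₀ + dressW (L ^ (j + 1)) W (bump (L ^ (j + 1)) c) := rfl
  rw [hsplit, bmeanIterW_add, Pi.add_apply]
  -- block locality: on the block of `z` the dressed bump is the constant-coefficient one with coefficient `c z`
  have hloc : bmeanIterW L (j + 1) W (dressW (L ^ (j + 1)) W (bump (L ^ (j + 1)) c)) z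
      = bmeanIterW L (j + 1) W (cbumpW (L ^ (j + 1)) W (c z)) z :=
    bmeanIterW_congr_block hL1 (j + 1) W _ _ z fun v hv => dressW_bump_block hM1 W c z hv
  have hK : bmeanIterW L (j + 1) W (cbumpW (L ^ (j + 1)) W (c z)) z = Kop L j W z (c z) + tentMean d (L ^ (j + 1)) • c z := by
    rw [Kop_apply, sub_add_cancel]
  have heq := nfixCoef_eq hL j hWu hx hsm hWx hE (fun z => t z - bmeanIterW L (j + 1) W F₀ z) z
  rw [hloc, hK, add_comm (Kop L j W z (c z)), heq]
  abel

/-- **CORNERS ARE UNTOUCHED**: `nfixW … F₀ t (M•z) = F₀ (M•z)` (`d ≥ 1`). [folklore] -/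
theorem nfixW_corner (hd : 0 < d) (F₀ t : Site d → Matrix n n ℂ) (z : Site d) :
    nfixW hL j hWu hx hsm hWx hE F₀ t ((((L ^ (j + 1) : ℕ) : ℤ)) • z) = F₀ ((((L ^ (j + 1) : ℕ) : ℤ)) • z) := by
  have hM1 : 1 ≤ L ^ (j + 1) := Nat.one_le_pow _ _ (by omega)
  unfold nfixW
  rw [dressW_corner hM1, bump_corner hM1 hd, add_zero]

/-- **SKEWNESS**: for 𝔲(n)-valued `F₀`, `t` the fixed competitor is 𝔲(n)-valued. [folklore] -/
theorem nfixW_mem_skewAdjoint {F₀ t : Site d → Matrix n n ℂ} (hF₀ : ∀ y, F₀ y ∈ skewAdjoint (Matrix n n ℂ))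
    (ht : ∀ z, t z ∈ skewAdjoint (Matrix n n ℂ)) (y : Site d) :
    nfixW hL j hWu hx hsm hWx hE F₀ t y ∈ skewAdjoint (Matrix n n ℂ) := by
  have hL1 : 1 ≤ L := by omega
  -- the nested mean of a skew field is skew (`star`-equivariance)
  have hmean : ∀ z, bmeanIterW L (j + 1) W F₀ z ∈ skewAdjoint (Matrix n n ℂ) := by
    intro z
    rw [skewAdjoint.mem_iff, star_bmeanIterW hL1 j hWu hx hsm hWx F₀ z]
    have hfun : (fun y => star (F₀ y)) = (-1 : ℝ) • F₀ := by
      funext y; rw [Pi.smul_apply, (skewAdjoint.mem_iff.mp (hF₀ y)), neg_one_smul]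
    rw [hfun, bmeanIterW_smul, Pi.smul_apply, neg_one_smul]
  have hδ : ∀ z, t z - bmeanIterW L (j + 1) W F₀ z ∈ skewAdjoint (Matrix n n ℂ) :=
    fun z => (skewAdjoint (Matrix n n ℂ)).sub_mem (ht z) (hmean z)
  unfold nfixW
  refine (skewAdjoint (Matrix n n ℂ)).add_mem (hF₀ y) (dressW_mem_skewAdjoint _ hWu ?_ y)
  intro w
  unfold bump
  exact skewAdjoint.smul_mem _ (nfixCoef_mem_skewAdjoint hL j hWu hx hsm hWx hE _ _ (hδ _))

/-- **PERIODICITY**: `W`, `F₀` of period `tower L N (j+1)` and `t` `N`-periodic ⇒ the fixed competitor has period `tower L N (j+1)`. [folklore] -/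
theorem nfixW_add_period {N : ℕ} (hWP : IsPeriodicCfg W ((tower L N (j + 1) : ℕ) : ℤ)) {F₀ t : Site d → Matrix n n ℂ}
    (hF₀ : ∀ (y : Site d) (i : Fin d), F₀ (y + ((tower L N (j + 1) : ℕ) : ℤ) • e i) = F₀ y)
    (ht : ∀ (z : Site d) (i : Fin d), t (z + (N : ℤ) • e i) = t z) (y : Site d) (τ : Fin d) :
    nfixW hL j hWu hx hsm hWx hE F₀ t (y + ((tower L N (j + 1) : ℕ) : ℤ) • e τ) = nfixW hL j hWu hx hsm hWx hE F₀ t y := by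
  have hL1 : 1 ≤ L := by omega
  have hM1 : 1 ≤ L ^ (j + 1) := Nat.one_le_pow _ _ hL1
  have htow : ((tower L N (j + 1) : ℕ) : ℤ) = ((L ^ (j + 1) * N : ℕ) : ℤ) := by rw [tower_eq_pow_mul]
  have hWP' : IsPeriodicCfg W (((L ^ (j + 1) : ℕ) : ℤ) * N) := by
    have : (((L ^ (j + 1) : ℕ) : ℤ) * N) = ((tower L N (j + 1) : ℕ) : ℤ) := by rw [htow]; push_cast; ring
    rw [this]; exact hWP
  -- the data of the coefficient are `N`-periodic
  have hδ : ∀ (z : Site d) (i : Fin d), t (z + (N : ℤ) • e i) - bmeanIterW L (j + 1) W F₀ (z + (N : ℤ) • e i)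
      = t z - bmeanIterW L (j + 1) W F₀ z := by
    intro z i
    rw [ht, bmeanIterW_add_period' j hWP hF₀ z i]
  have hbump : ∀ (x' : Site d) (i : Fin d),
      bump (L ^ (j + 1)) (nfixCoef hL j hWu hx hsm hWx hE (fun z => t z - bmeanIterW L (j + 1) W F₀ z))
          (x' + (((L ^ (j + 1) : ℕ) : ℤ) * N) • e i)
        = bump (L ^ (j + 1)) (nfixCoef hL j hWu hx hsm hWx hE (fun z => t z - bmeanIterW L (j + 1) W F₀ z)) x' := by
    intro x' i
    have h := bump_add_period hM1 (nfixCoef_add_period hL j hWu hx hsm hWx hE hWP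
      (δ := fun z => t z - bmeanIterW L (j + 1) W F₀ z) hδ) x' i
    have hc : ((L ^ (j + 1) * N : ℕ) : ℤ) = ((L ^ (j + 1) : ℕ) : ℤ) * N := by push_cast; ring
    rwa [hc] at h
  unfold nfixW
  rw [hF₀, htow, show (((L ^ (j + 1) * N : ℕ) : ℤ)) = ((L ^ (j + 1) : ℕ) : ℤ) * N by push_cast; ring,
    dressW_add_period hM1 hWP' hbump]

omit [Nonempty n] in
/-- `gaugeDir` is additive in the field. [folklore] -/
theorem gaugeDir_add'' (F G : Site d → Matrix n n ℂ) (y : Site d) (α : Fin d) :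
    gaugeDir W (fun x => F x + G x) y α = gaugeDir W F y α + gaugeDir W G y α := by
  simp only [gaugeDir, Ad_add]; abel

/-- **THE ENERGY OF THE FIX** (`SmallField W a`, `0 ≤ a`, any `N`):
`Σ_{y∈periodBox(M·N)} Σ_α ‖gaugeDir W (nfixW … F₀ t) y α‖² ≤ 2·Σ‖gaugeDir W F₀‖²
  + 2·(d·M^d·(1∕M + 2(d−1)(M−1)a)²)·(2∕tentMean)²·Σ_{z∈periodBox N} ‖t z − bmeanIterW L (j+1) W F₀ z‖²`. [folklore] -/
theorem sum_normSq_gaugeDir_nfixW_le (N : ℕ) {a : ℝ} (ha : 0 ≤ a) (hWa : SmallField W a) (F₀ t : Site d → Matrix n n ℂ) :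
    ∑ y ∈ periodBox (d := d) (L ^ (j + 1) * N), ∑ α : Fin d, ‖gaugeDir W (nfixW hL j hWu hx hsm hWx hE F₀ t) y α‖ ^ 2
      ≤ 2 * ∑ y ∈ periodBox (d := d) (L ^ (j + 1) * N), ∑ α : Fin d, ‖gaugeDir W F₀ y α‖ ^ 2
        + 2 * ((d : ℝ) * (((L ^ (j + 1) : ℕ) : ℝ)) ^ d
              * (1 / (((L ^ (j + 1) : ℕ) : ℝ)) + 2 * (((d : ℝ) - 1) * ((((L ^ (j + 1) : ℕ) : ℝ)) - 1) * a)) ^ 2)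
            * ((2 / tentMean d (L ^ (j + 1))) ^ 2
              * ∑ z ∈ periodBox (d := d) N, ‖t z - bmeanIterW L (j + 1) W F₀ z‖ ^ 2) := by
  have hL1 : 1 ≤ L := by omega
  have hM1 : 1 ≤ L ^ (j + 1) := Nat.one_le_pow _ _ hL1
  have ht0 := tentMean_pos (Nat.le_trans hL (Nat.le_self_pow (Nat.succ_ne_zero j) L)) d
  set c := nfixCoef hL j hWu hx hsm hWx hE (fun z => t z - bmeanIterW L (j + 1) W F₀ z) with hc
  -- the dressed bump's energy against the coefficient, and the coefficient against the data
  have hE3 := sum_normSq_gaugeDir_dressW_bump_le hM1 N hWu ha hWa c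
  have hcoef : ∑ z ∈ periodBox (d := d) N, ‖c z‖ ^ 2
      ≤ (2 / tentMean d (L ^ (j + 1))) ^ 2 * ∑ z ∈ periodBox (d := d) N, ‖t z - bmeanIterW L (j + 1) W F₀ z‖ ^ 2 := by
    rw [Finset.mul_sum]
    refine Finset.sum_le_sum fun z _ => ?_
    have h := norm_nfixCoef_le hL j hWu hx hsm hWx hE (fun z => t z - bmeanIterW L (j + 1) W F₀ z) z
    have h0 : 0 ≤ 2 / tentMean d (L ^ (j + 1)) * ‖t z - bmeanIterW L (j + 1) W F₀ z‖ := by positivity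
    calc ‖c z‖ ^ 2 ≤ (2 / tentMean d (L ^ (j + 1)) * ‖t z - bmeanIterW L (j + 1) W F₀ z‖) ^ 2 :=
          pow_le_pow_left₀ (norm_nonneg _) h 2
      _ = _ := by ring
  -- split the covariant gradient
  have hsplit : ∀ (y : Site d) (α : Fin d), ‖gaugeDir W (nfixW hL j hWu hx hsm hWx hE F₀ t) y α‖ ^ 2
      ≤ 2 * ‖gaugeDir W F₀ y α‖ ^ 2 + 2 * ‖gaugeDir W (dressW (L ^ (j + 1)) W (bump (L ^ (j + 1)) c)) y α‖ ^ 2 := by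
    intro y α
    have h1 : gaugeDir W (nfixW hL j hWu hx hsm hWx hE F₀ t) y α
        = gaugeDir W F₀ y α + gaugeDir W (dressW (L ^ (j + 1)) W (bump (L ^ (j + 1)) c)) y α := gaugeDir_add'' F₀ _ y α
    rw [h1]
    have h := norm_add_le (gaugeDir W F₀ y α) (gaugeDir W (dressW (L ^ (j + 1)) W (bump (L ^ (j + 1)) c)) y α)
    calc _ ≤ (‖gaugeDir W F₀ y α‖ + ‖gaugeDir W (dressW (L ^ (j + 1)) W (bump (L ^ (j + 1)) c)) y α‖) ^ 2 :=
          pow_le_pow_left₀ (norm_nonneg _) h 2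
      _ ≤ _ := by
          nlinarith only [sq_nonneg (‖gaugeDir W F₀ y α‖ - ‖gaugeDir W (dressW (L ^ (j + 1)) W (bump (L ^ (j + 1)) c)) y α‖)]
  have hsum : ∑ y ∈ periodBox (d := d) (L ^ (j + 1) * N), ∑ α : Fin d, ‖gaugeDir W (nfixW hL j hWu hx hsm hWx hE F₀ t) y α‖ ^ 2
      ≤ 2 * ∑ y ∈ periodBox (d := d) (L ^ (j + 1) * N), ∑ α : Fin d, ‖gaugeDir W F₀ y α‖ ^ 2
        + 2 * ∑ y ∈ periodBox (d := d) (L ^ (j + 1) * N), ∑ α : Fin d,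
            ‖gaugeDir W (dressW (L ^ (j + 1)) W (bump (L ^ (j + 1)) c)) y α‖ ^ 2 := by
    refine (Finset.sum_le_sum fun y _ => Finset.sum_le_sum fun α _ => hsplit y α).trans (le_of_eq ?_)
    simp only [Finset.sum_add_distrib, Finset.mul_sum]
  have hκ0 : 0 ≤ (d : ℝ) * (((L ^ (j + 1) : ℕ) : ℝ)) ^ d
      * (1 / (((L ^ (j + 1) : ℕ) : ℝ)) + 2 * (((d : ℝ) - 1) * ((((L ^ (j + 1) : ℕ) : ℝ)) - 1) * a)) ^ 2 := by positivity
  have hE3' := hE3.trans (mul_le_mul_of_nonneg_left hcoef hκ0)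
  linarith only [hsum, hE3']

end Fix

end

end Summit.QuantumFields.BalabanUV.T4Continuum.NE3CompetitorNestedFix
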